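import Summits.NavierStokesRegularity.FunctionalMining.VelocityL6NonlinearPoincare
import HarnessLib

/-!
# FunctionalMining — the `β`-Hölder radial map and Jensen/Hölder tools for real exponents

Search for candidate a priori estimates; no regularity claim. Cell `pub-nsfunc`, prove seat
(gen 9). Static real-analysis lemmas, nothing about Navier–Stokes.

Toward the K0 rows `E.q|T_LD|G1` for REAL `q` (SIEVELD §3.2, Theorem G: `q = 5/2, 3, 10/3, 5`
after the natural-power rows `q = 4, 6`), the coercive step is the no-go seat's Lemma NP at a real
parameter `a = (q−2)/2`: `∫|v|^{2a+2} ≤ C ∫|v|^{2a}|∇v|²` for zero-mean `v`. Its constructive proof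
(tree: `a = 1` in `VelocityL4NonlinearPoincare`, `a = 2` in `VelocityL6NonlinearPoincare`) inverts
`W = |v|^a v` by the radial map `g(w) = ‖w‖^{β−1} w`, `β = 1/(1+a)`, and needs `g` to be
`β`-Hölder. This file proves that for every `0 < β ≤ 1` with the constant `3`, in any real normed
space, together with the two real-exponent integral tools used downstream on `T^d`
(Jensen `∫f^β ≤ (∫f)^β` and Hölder with weights `a + b = 1`).

## Main statements

* `norm_rpow_smul_sub_le` — `‖‖x‖^{β−1}x − ‖y‖^{β−1}y‖ ≤ 3‖x − y‖^β` (`0 < β ≤ 1`).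
* `integral_mul_le_rpow_mul_rpow` — Hölder on `T^d` for continuous non-negative functions.
* `integral_rpow_le_rpow_integral` — Jensen `∫ f^β ≤ (∫ f)^β` on `T^d`, `0 < β ≤ 1`.
-/

noncomputable section

open MeasureTheory Finset Set
open scoped InnerProductSpace RealInnerProductSpace

namespace Summit.NavierStokesRegularity.FunctionalMining

open Literature.Analysis.FunctionSpaces Literature.Analysis.FunctionSpaces.Torus

namespace NonlinearPoincare

/-! ## 1. The radial map `w ↦ ‖w‖^{β−1} w` is `β`-Hölder -/

section Holder

variable {E : Type*} [NormedAddCommGroup E] [NormedSpace ℝ E]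

/-- For `0 ≤ t ≤ 1` and `0 < β ≤ 1`: `t^β − t ≤ (1 − t)^β` (`t^β ≤ 1` and `1 − t ≤ (1−t)^β`).
[folklore] -/
theorem rpow_sub_self_le {t β : ℝ} (ht0 : 0 ≤ t) (ht1 : t ≤ 1) (hβ0 : 0 < β) (hβ1 : β ≤ 1) :
    t ^ β - t ≤ (1 - t) ^ β := by
  have h1 : t ^ β ≤ 1 := Real.rpow_le_one ht0 ht1 hβ0.le
  have h3 : 1 - t ≤ (1 - t) ^ β := by
    have h := Real.rpow_le_rpow_of_exponent_ge' (x := 1 - t) (by linarith) (by linarith) hβ0.le hβ1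
    rwa [Real.rpow_one] at h
  linarith

/-- **The radial map `g(w) = ‖w‖^{β−1} w` is `β`-Hölder with constant `3`** (`0 < β ≤ 1`, any
real normed space): `‖g x − g y‖ ≤ 3 ‖x − y‖^β`. With `‖y‖ ≤ ‖x‖ = r`:
`g x − g y = r^{β−1}(x − y) + (r^{β−1} − ‖y‖^{β−1}) y`; the first term is
`≤ 2^{1−β}‖x−y‖^β` because `‖x − y‖ ≤ 2r`, the second has norm `s^β − s r^{β−1} = r^β(t^β − t)`
(`s = ‖y‖ = tr`) `≤ r^β(1−t)^β = (r − s)^β ≤ ‖x − y‖^β`. [ours; elementary] -/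
theorem norm_rpow_smul_sub_le {β : ℝ} (hβ0 : 0 < β) (hβ1 : β ≤ 1) (x y : E) :
    ‖‖x‖ ^ (β - 1) • x - ‖y‖ ^ (β - 1) • y‖ ≤ 3 * ‖x - y‖ ^ β := by
  wlog hxy : ‖y‖ ≤ ‖x‖ generalizing x y
  · have h := this y x (le_of_not_ge hxy)
    rw [norm_sub_rev y x] at h
    rwa [norm_sub_rev]
  rcases eq_or_ne x 0 with hx | hx
  · have hy : y = 0 := by
      rw [hx, norm_zero] at hxy
      exact norm_le_zero_iff.1 hxy
    subst hx; subst hy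
    simp [Real.zero_rpow hβ0.ne']
  obtain ⟨r, hr⟩ : ∃ r : ℝ, r = ‖x‖ := ⟨_, rfl⟩
  have hr0 : 0 < r := by rw [hr]; exact norm_pos_iff.2 hx
  have hyr : ‖y‖ ≤ r := by rw [hr]; exact hxy
  have hdec : ‖x‖ ^ (β - 1) • x - ‖y‖ ^ (β - 1) • y =
      r ^ (β - 1) • (x - y) + (r ^ (β - 1) - ‖y‖ ^ (β - 1)) • y := by
    rw [smul_sub, sub_smul, ← hr]; abel
  -- first term
  have h1 : ‖r ^ (β - 1) • (x - y)‖ ≤ 2 * ‖x - y‖ ^ β := by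
    rw [norm_smul, Real.norm_of_nonneg (Real.rpow_nonneg hr0.le _)]
    rcases eq_or_ne ‖x - y‖ 0 with h0 | h0
    · rw [h0, Real.zero_rpow hβ0.ne']; simp
    have hD0 : 0 < ‖x - y‖ := lt_of_le_of_ne (norm_nonneg _) (Ne.symm h0)
    have hD : ‖x - y‖ ≤ 2 * r := by
      calc ‖x - y‖ ≤ ‖x‖ + ‖y‖ := norm_sub_le _ _
        _ ≤ 2 * r := by rw [← hr]; linarith
    have e : ‖x - y‖ ^ (1 - β) * ‖x - y‖ ^ β = ‖x - y‖ := by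
      rw [← Real.rpow_add hD0, show (1 : ℝ) - β + β = 1 by ring, Real.rpow_one]
    have e2 : ‖x - y‖ ^ (1 - β) ≤ (2 * r) ^ (1 - β) :=
      Real.rpow_le_rpow (norm_nonneg _) hD (by linarith)
    have e3 : r ^ (β - 1) * (2 * r) ^ (1 - β) = 2 ^ (1 - β) := by
      rw [Real.mul_rpow (by norm_num) hr0.le]
      have : r ^ (β - 1) * r ^ (1 - β) = 1 := by
        rw [← Real.rpow_add hr0, show β - 1 + (1 - β) = 0 by ring, Real.rpow_zero]
      calc r ^ (β - 1) * ((2 : ℝ) ^ (1 - β) * r ^ (1 - β))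
          = 2 ^ (1 - β) * (r ^ (β - 1) * r ^ (1 - β)) := by ring
        _ = 2 ^ (1 - β) := by rw [this, mul_one]
    have e4 : (2 : ℝ) ^ (1 - β) ≤ 2 := by
      calc (2 : ℝ) ^ (1 - β) ≤ (2 : ℝ) ^ (1 : ℝ) :=
            Real.rpow_le_rpow_of_exponent_le (by norm_num) (by linarith)
        _ = 2 := Real.rpow_one 2
    have hb0 : 0 ≤ ‖x - y‖ ^ β := Real.rpow_nonneg (norm_nonneg _) _
    calc r ^ (β - 1) * ‖x - y‖ = r ^ (β - 1) * (‖x - y‖ ^ (1 - β) * ‖x - y‖ ^ β) := by rw [e]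
      _ ≤ r ^ (β - 1) * ((2 * r) ^ (1 - β) * ‖x - y‖ ^ β) :=
          mul_le_mul_of_nonneg_left (mul_le_mul_of_nonneg_right e2 hb0)
            (Real.rpow_nonneg hr0.le _)
      _ = (r ^ (β - 1) * (2 * r) ^ (1 - β)) * ‖x - y‖ ^ β := by ring
      _ = 2 ^ (1 - β) * ‖x - y‖ ^ β := by rw [e3]
      _ ≤ 2 * ‖x - y‖ ^ β := mul_le_mul_of_nonneg_right e4 hb0
  -- second term
  have h2 : ‖(r ^ (β - 1) - ‖y‖ ^ (β - 1)) • y‖ ≤ ‖x - y‖ ^ β := by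
    rcases eq_or_ne y 0 with hy | hy
    · rw [hy, smul_zero, norm_zero]; exact Real.rpow_nonneg (norm_nonneg _) _
    obtain ⟨s, hs⟩ : ∃ s : ℝ, s = ‖y‖ := ⟨_, rfl⟩
    have hs0 : 0 < s := by rw [hs]; exact norm_pos_iff.2 hy
    have hsr : s ≤ r := by rw [hs]; exact hyr
    obtain ⟨t, ht⟩ : ∃ t : ℝ, t = s / r := ⟨_, rfl⟩
    have ht0 : 0 < t := by rw [ht]; exact div_pos hs0 hr0
    have ht1 : t ≤ 1 := by rw [ht]; exact (div_le_one hr0).2 hsr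
    have hst : s = t * r := by rw [ht]; field_simp
    have hmono : r ^ (β - 1) ≤ s ^ (β - 1) :=
      Real.rpow_le_rpow_of_nonpos hs0 hsr (by linarith)
    rw [norm_smul, Real.norm_eq_abs, ← hs, abs_of_nonpos (by linarith), neg_sub]
    have key : (s ^ (β - 1) - r ^ (β - 1)) * s = r ^ β * (t ^ β - t) := by
      have a1 : s ^ (β - 1) * s = s ^ β := by
        calc s ^ (β - 1) * s = s ^ (β - 1) * s ^ (1 : ℝ) := by rw [Real.rpow_one]
          _ = s ^ β := by rw [← Real.rpow_add hs0, show β - 1 + 1 = β by ring]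
      have a2 : s ^ β = t ^ β * r ^ β := by rw [hst, Real.mul_rpow ht0.le hr0.le]
      have a3 : r ^ (β - 1) * s = t * r ^ β := by
        rw [hst]
        calc r ^ (β - 1) * (t * r) = t * (r ^ (β - 1) * r ^ (1 : ℝ)) := by
              rw [Real.rpow_one]; ring
          _ = t * r ^ β := by rw [← Real.rpow_add hr0, show β - 1 + 1 = β by ring]
      calc (s ^ (β - 1) - r ^ (β - 1)) * s = s ^ (β - 1) * s - r ^ (β - 1) * s := by ring
        _ = t ^ β * r ^ β - t * r ^ β := by rw [a1, a2, a3]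
        _ = r ^ β * (t ^ β - t) := by ring
    have key2 : r ^ β * (1 - t) ^ β ≤ ‖x - y‖ ^ β := by
      have b1 : r * (1 - t) = r - s := by rw [hst]; ring
      have b2 : r - s ≤ ‖x - y‖ := by rw [hr, hs]; exact norm_sub_norm_le x y
      have b3 : 0 ≤ r * (1 - t) := by rw [b1]; linarith
      calc r ^ β * (1 - t) ^ β = (r * (1 - t)) ^ β := by rw [Real.mul_rpow hr0.le (by linarith)]
        _ ≤ ‖x - y‖ ^ β := Real.rpow_le_rpow b3 (by rw [b1]; exact b2) hβ0.le
    rw [key]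
    calc r ^ β * (t ^ β - t) ≤ r ^ β * (1 - t) ^ β :=
          mul_le_mul_of_nonneg_left (rpow_sub_self_le ht0.le ht1 hβ0 hβ1)
            (Real.rpow_nonneg hr0.le _)
      _ ≤ ‖x - y‖ ^ β := key2
  calc ‖‖x‖ ^ (β - 1) • x - ‖y‖ ^ (β - 1) • y‖
      = ‖r ^ (β - 1) • (x - y) + (r ^ (β - 1) - ‖y‖ ^ (β - 1)) • y‖ := by rw [hdec]
    _ ≤ ‖r ^ (β - 1) • (x - y)‖ + ‖(r ^ (β - 1) - ‖y‖ ^ (β - 1)) • y‖ := norm_add_le _ _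
    _ ≤ 2 * ‖x - y‖ ^ β + ‖x - y‖ ^ β := add_le_add h1 h2
    _ = 3 * ‖x - y‖ ^ β := by ring

/-- The radial map inverts `w = ‖v‖^a v`: with `β = 1/(1+a)`, `‖w‖^{β−1} w = v`. [folklore] -/
theorem rpow_smul_rpow_smul {a β : ℝ} (ha : 0 < a) (hβ : β = (1 + a)⁻¹) (v : E) :
    ‖‖v‖ ^ a • v‖ ^ (β - 1) • (‖v‖ ^ a • v) = v := by
  rcases eq_or_ne v 0 with hv | hv
  · subst hv; simp
  have hn : 0 < ‖v‖ := norm_pos_iff.2 hv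
  have h1 : ‖‖v‖ ^ a • v‖ = ‖v‖ ^ (a + 1) := by
    rw [norm_smul, Real.norm_of_nonneg (Real.rpow_nonneg hn.le _), Real.rpow_add hn,
      Real.rpow_one]
  have ha1 : (1 + a) ≠ 0 := by linarith
  have h2 : (‖v‖ ^ (a + 1)) ^ (β - 1) = ‖v‖ ^ (-a) := by
    rw [← Real.rpow_mul hn.le]
    congr 1
    rw [hβ]; field_simp; ring
  rw [h1, h2, smul_smul, ← Real.rpow_add hn, neg_add_cancel, Real.rpow_zero, one_smul]

end Holder

/-! ## 2. Hölder and Jensen with real exponents on `T^d` -/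

variable {d : Type*} [Fintype d]

/-- **Hölder on `T^d` with weights `a + b = 1`** for continuous non-negative `f, g`:
`∫ f g ≤ (∫ f^{1/a})^a (∫ g^{1/b})^b`. [folklore] -/
theorem integral_mul_le_rpow_mul_rpow {f g : UnitAddTorus d → ℝ} (hf : Continuous f)
    (hg : Continuous g) (hf0 : ∀ x, 0 ≤ f x) (hg0 : ∀ x, 0 ≤ g x) {a b : ℝ} (ha : 0 < a)
    (hb : 0 < b) (hab : a + b = 1) :
    ∫ x, f x * g x ≤ (∫ x, f x ^ a⁻¹) ^ a * (∫ x, g x ^ b⁻¹) ^ b := by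
  have hpq : (a⁻¹).HolderConjugate b⁻¹ := Real.HolderConjugate.inv_inv ha hb hab
  have h := integral_mul_le_Lp_mul_Lq_of_nonneg (μ := volume) hpq (ae_of_all _ hf0)
    (ae_of_all _ hg0) (hf.memLp_of_hasCompactSupport (HasCompactSupport.of_compactSpace f))
    (hg.memLp_of_hasCompactSupport (HasCompactSupport.of_compactSpace g))
  simpa only [one_div, inv_inv] using h

/-- **Jensen on `T^d` for the concave power `t ↦ t^β`, `0 < β ≤ 1`**: for continuous `f ≥ 0`,
`∫ f^β ≤ (∫ f)^β` (Hölder against the constant `1`). [folklore] -/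
theorem integral_rpow_le_rpow_integral {f : UnitAddTorus d → ℝ} (hf : Continuous f)
    (hf0 : ∀ x, 0 ≤ f x) {β : ℝ} (hβ0 : 0 < β) (hβ1 : β ≤ 1) :
    ∫ x, f x ^ β ≤ (∫ x, f x) ^ β := by
  rcases hβ1.eq_or_lt with h1 | h1
  · subst h1; simp only [Real.rpow_one]; exact le_rfl
  have hb : 0 < 1 - β := by linarith
  have h := integral_mul_le_rpow_mul_rpow (f := fun x => f x ^ β) (g := fun _ => (1 : ℝ))
    (hf.rpow_const fun x => Or.inr hβ0.le) continuous_const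
    (fun x => Real.rpow_nonneg (hf0 x) _) (fun _ => zero_le_one) hβ0 hb (by ring)
  have e1 : ∀ x, (f x ^ β) ^ β⁻¹ = f x := fun x => by
    rw [← Real.rpow_mul (hf0 x), mul_inv_cancel₀ hβ0.ne', Real.rpow_one]
  simp only [mul_one, e1, Real.one_rpow, integral_const, smul_eq_mul, probReal_univ] at h
  exact h

end NonlinearPoincare

end Summit.NavierStokesRegularity.FunctionalMining
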